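import Summits.KontsevichZagierPeriods.KontsevichZagierPeriods.Theses.HurwitzMicroSectors
import Summits.KontsevichZagierPeriods.KontsevichZagierPeriods.Theorems.SectorTwoSix.Negative.LoadBearing
import Literature.NumberTheory.Transcendental.BoxCoordinatePowerMap

/-!
# `SectorTwoSix` (stmt-KontsevichZagierPeriods-3870) — line `jacobian-monomial-absorption`,
# stub `stub_dilationTwo`: the engine (the `n = 2` dilation move)

For `m ≥ 1` and two representations `r, r'` of the Kontsevich–Zagier calculus on the open unit
box `(0,1)²` with `r.integrand x = r'.integrand (x₀ᵐ, x₁ᵐ) · m² (x₀x₁)ᵐ⁻¹` on the box, the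
difference `[r] − [r']` is ONE change-of-variables generator (`KZ.changeOfVariablesRel`, rule (2)
of [Kontsevich–Zagier 2001, §1.2]). The witness is the diagonal power map
`Φₘ = BoxIntegral.coordPow m` (`x ↦ (xᵢᵐ)ᵢ`) with derivative `BoxIntegral.coordPowDeriv m`
(tree file `Literature/NumberTheory/Transcendental/BoxCoordinatePowerMap.lean`): it is the
polynomial map `(Xᵢ ^ m)ᵢ` hence `ℚ`-semialgebraic on the box (`isSemialgebraicMapOn_aeval`,
`KZ.isSemialgebraic_box`), differentiable within the box (`hasFDerivWithinAt_coordPow`),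
injective on the box (`injOn_coordPow_box`), with image exactly the box (`image_coordPow_box`)
and Jacobian `|det Φₘ'(x)| = m² x₀ᵐ⁻¹ x₁ᵐ⁻¹ = m² (x₀x₁)ᵐ⁻¹` there (`abs_det_coordPowDeriv`).
This is the `n = 2` case of the route's engine `DilationMove`, with the Jacobian monomial
written in the variable `t = x₀x₁` of the sector.

## References

* M. Kontsevich, D. Zagier, *Periods* (2001), §1.2, rule (2).
* J. Bochnak, M. Coste, M.-F. Roy, *Real Algebraic Geometry* (1998), §2.2.
-/

noncomputable section

open Set MeasureTheory Polynomial
open Literature.NumberTheory.Transcendental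
open Summit.KontsevichZagierPeriods.Theorems.SectorTwoSix.Negative

namespace Summit.KontsevichZagierPeriods.Theorems.HurwitzMicroSectorsSectorTwoSix

/-- **The engine at `n = 2` (the dilation move on the open unit square).** For `m ≥ 1` and
representations `r, r'` on the open unit box `(0,1)²` with
`r.integrand x = r'.integrand (x₀ᵐ, x₁ᵐ) · m² (x₀x₁)ᵐ⁻¹` on the box, `[r] − [r']` is ONE
change-of-variables move: `Φₘ(x) = (x₀ᵐ, x₁ᵐ)` is polynomial hence `ℚ`-semialgebraic on the box,
differentiable, injective on the box with `Φₘ '' (0,1)² = (0,1)²`, and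
`|det Φₘ'(x)| = m² x₀ᵐ⁻¹ x₁ᵐ⁻¹ = m² (x₀x₁)ᵐ⁻¹` on the box (tree `BoxCoordinatePowerMap`).
[Kontsevich–Zagier 2001, §1.2, rule (2)] -/
theorem stub_dilationTwo : ∀ (m : ℕ), 1 ≤ m → ∀ (r r' : KZ.IntegralRep 2),
    r.domain = {x | ∀ i, x i ∈ Set.Ioo (0:ℝ) 1} → r'.domain = {x | ∀ i, x i ∈ Set.Ioo (0:ℝ) 1} →
    (∀ x ∈ r.domain, r.integrand x =
      r'.integrand (fun i => x i ^ m) * ((m : ℝ) ^ 2 * (x 0 * x 1) ^ (m - 1))) →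
    KZ.of r - KZ.of r' ∈ KZ.changeOfVariablesRel := by
  intro m hm r r' hr hr' h
  have hm0 : m ≠ 0 := by omega
  refine ⟨2, r, r', BoxIntegral.coordPow m, BoxIntegral.coordPowDeriv m, ?_,
    fun x _ => BoxIntegral.hasFDerivWithinAt_coordPow m _ x, ?_, ?_, fun x hx => ?_, rfl⟩
  · rw [hr]
    exact (isSemialgebraicMapOn_aeval (KZ.isSemialgebraic_box 2)
      fun j => (MvPolynomial.X j : MvPolynomial (Fin 2) ℚ) ^ m).congr fun x _ => by ext j; simp
  · rw [hr]
    exact BoxIntegral.injOn_coordPow_box hm0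
  · rw [hr, hr']
    exact (BoxIntegral.image_coordPow_box hm0).symm
  · have hx' : ∀ i, x i ∈ Ioo (0:ℝ) 1 := by rw [hr] at hx; exact hx
    rw [h x hx, BoxIntegral.abs_det_coordPowDeriv hm0 hx', Fin.prod_univ_two, mul_pow]
    rfl

end Summit.KontsevichZagierPeriods.Theorems.HurwitzMicroSectorsSectorTwoSix

end
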